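import Literature.Probability.Percolation.KozmaNitzanScheme
import HarnessLib

/-!
# Kozma–Nitzan's renormalization cells IN THE PLANE `ℤ²` (the planar factor of the anchored cells of `X □ ℤ²`), part 1: squares `Q_v`, `M_v`,
# cells, between-boxes, `E_{v,x}`, stubs, stub zones; membership; one-dimensional comparisons; containments (BLUEPRINT-I-PHI §1 row "cells")

builds on p205010 (kernel theorem, internal audit signed; external expert review pending) — nothing in this file uses p205010.
Lane `prim-bschramm`, seat `prim-bschramm-p3` (the `X □ ℤ²` instance of p2-g2's anchored cell geometry `KNCells.CellGeom`, planar factor);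
helper file (`--supports stmt-CriticalPhenomena-4575 --as helper`).

`L/KozmaNitzanScheme.lean` builds KN's cells inside `ℤ^d`, `d ≥ 3` (`Cells d`: the planar lattice `20r·ℤ²` embedded on the axes `x₁, x₂`).
For the product `X □ ℤ²` the cells are `B_X(anchor, R) × (planar cell)`, so the planar factor is needed as subsets of `Site 2` itself:
this file re-types the boxes of `Cells` at `d = 2` (same constants: `r = Ks`, centres `20 r v`, `Q_v = [-5r,5r]²`, `M_v = [-3r,3r]²`,
cell `[-10r,10r]²`, between-box `{5r < σ x_a < 15r} × [-5r,5r]`, `E^far = {5r < σ x_a ≤ 25r} × [-5r,5r]`, stubs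
`{5r ≤ σ x_a ≤ 5r+10sj} × [-2r,2r]`, zone `{10r ≤ σ x_a ≤ 15r-10s} × [-2r,2r]`) and proves the PLANAR halves of the fields of p2-g2's
`SepGeom` / `ExitGeom` / `RunGeom` (which hold for all anchors): containments `Q ⊆ Cell`, `Btw ⊆ Cell ∪ Cell'`, `Stub ⊆ Q ∪ Btw`,
`Stub ⊆ Cell ∪ Zone`, `Efar ⊆ Btw ∪ Q'`, `M ⊆ Q`; disjointness `Q/Q`, `Q/Btw`, `Btw/Btw`, `Q/Efar`, `Btw/Efar`, `Ewv/Efar`, `Cell/Q`,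
`Zone/Q`; the column facts (`cen x ∈ Q_x`, `cen x ∉ Cell_u (u ≠ x)`, `cen x ∉ Zone`); self-adjacency of `Q`, `Btw`, `Stub`.
All proofs are one-dimensional interval comparisons along a planar axis (`oneD_*`).

[cite: KozmaNitzan2024, §4 pp. 25–26 (Q_v, M_v, E_{v,x}, H^j_{v,x}) — the ℤ^d model]
-/

noncomputable section

namespace Summit.CriticalPhenomena.PercolationContinuityZ3.Theorems

namespace Transplant

open Literature.Probability.Percolation Literature.Probability.LatticeModels SimpleGraph GadgetSystem Contour
open Literature.Probability.Percolation.KozmaNitzan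
open Literature.Probability.Percolation.KozmaNitzan.Cells (oth oth_ne sgOf sgOf_sign stepVec_apply_fst stepVec_apply_oth eq_oth_of_ne oth_oth
  eq_of_coords)

/-- **The parameters of the planar cells**: the number of stub levels `K ≥ 20` and the stub increment `s ≥ 1`; the scale is `r = Ks`.
[cite: KozmaNitzan2024, §4 pp. 25–26] -/
structure PCells where
  /-- the number of stub levels -/
  K : ℕ
  /-- the stub increment `r / K` -/
  s : ℕ
  /-- `K ≥ 20` -/
  hK : 20 ≤ K
  /-- `s ≥ 1` -/
  hs : 1 ≤ s

namespace PCells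

variable (C : PCells)

/-- The scale `r = Ks`. [cite: KozmaNitzan2024, §4 p. 26] -/
def r : ℕ := C.K * C.s

/-- `1 ≤ r`. [folklore] -/
theorem one_le_r : (1 : ℕ) ≤ C.r := by
  have := C.hK; have := C.hs; unfold r; nlinarith

/-- `20 s ≤ r`. [folklore] -/
theorem twenty_mul_s_le_r : 20 * C.s ≤ (C.r : ℕ) := by
  unfold r; exact Nat.mul_le_mul_right _ C.hK

/-- The centre `20 r v` of the macro-vertex `v`. [cite: KozmaNitzan2024, §4 p. 26] -/
def cen (v : Site 2) : Site 2 := fun i => 20 * (C.r : ℤ) * v i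

/-- The centre, coordinatewise. [folklore] -/
@[simp] theorem cen_apply (v : Site 2) (i : Fin 2) : C.cen v i = 20 * (C.r : ℤ) * v i := rfl

/-- Centres are monotone along a coordinate, with gaps of `20 r`. [folklore] -/
theorem cen_gap {u v : Site 2} {i : Fin 2} (h : u i + 1 ≤ v i) : C.cen u i + 20 * (C.r : ℤ) ≤ C.cen v i := by
  simp only [cen_apply]; nlinarith [C.one_le_r]

/-- Equal coordinates give equal centre coordinates. [folklore] -/
theorem cen_congr {u v : Site 2} {i : Fin 2} (h : u i = v i) : C.cen u i = C.cen v i := by simp only [cen_apply, h]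

/-- The centre of the macro-neighbour along the axis of the step. [folklore] -/
theorem cen_add_stepVec_fst (v : Site 2) (δ : MDir) : C.cen (v + stepVec δ) δ.1 = C.cen v δ.1 + sgOf δ * (20 * (C.r : ℤ)) := by
  simp only [cen_apply, Pi.add_apply, stepVec_apply_fst]; ring

/-- The centre of the macro-neighbour across the axis of the step. [folklore] -/
theorem cen_add_stepVec_oth (v : Site 2) (δ : MDir) : C.cen (v + stepVec δ) (oth δ.1) = C.cen v (oth δ.1) := by
  simp only [cen_apply, Pi.add_apply, stepVec_apply_oth, add_zero]

/-! ## The boxes -/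

/-- `Q_v = cen v + [-5r, 5r]²`. [cite: KozmaNitzan2024, §4 p. 26 (Q_v)] -/
def Q (v : Site 2) : Finset (Site 2) := Finset.Icc (C.cen v - ((5 * C.r : ℕ) : Site 2)) (C.cen v + ((5 * C.r : ℕ) : Site 2))

/-- `M_v = cen v + [-3r, 3r]²`. [cite: KozmaNitzan2024, §4 p. 26 (M_v)] -/
def M (v : Site 2) : Finset (Site 2) := Finset.Icc (C.cen v - ((3 * C.r : ℕ) : Site 2)) (C.cen v + ((3 * C.r : ℕ) : Site 2))

/-- The cell `cen v + [-10r, 10r]²`. [folklore] -/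
def Cell (v : Site 2) : Finset (Site 2) := Finset.Icc (C.cen v - ((10 * C.r : ℕ) : Site 2)) (C.cen v + ((10 * C.r : ℕ) : Site 2))

/-- The between-box `cen v + {5r < σ x_a < 15r} × [-5r,5r]`. [cite: KozmaNitzan2024, §4 p. 26 (E_{v,x})] -/
def Btw (v : Site 2) (δ : MDir) : Finset (Site 2) := sBox δ.1 (sgOf δ) (C.cen v) (5 * C.r + 1) (15 * C.r - 1) (5 * C.r)

/-- `E^far_{v,x} = cen v + {5r < σ x_a ≤ 25r} × [-5r,5r]`. [cite: KozmaNitzan2024, §4 p. 26 (E_{v,x})] -/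
def Efar (v : Site 2) (δ : MDir) : Finset (Site 2) := sBox δ.1 (sgOf δ) (C.cen v) (5 * C.r + 1) (25 * C.r) (5 * C.r)

/-- `E_{v,x} = Btw ∪ Q_x`. [cite: KozmaNitzan2024, §4 p. 26 (E_{v,x})] -/
def Ewv (v : Site 2) (δ : MDir) : Finset (Site 2) := C.Btw v δ ∪ C.Q (v + stepVec δ)

/-- The stub `H^j_{v,x} = cen v + {5r ≤ σ x_a ≤ 5r + 10sj} × [-2r,2r]`. [cite: KozmaNitzan2024, §4 p. 26 (H^j_{v,x})] -/
def Stub (v : Site 2) (δ : MDir) (j : ℕ) : Finset (Site 2) := sBox δ.1 (sgOf δ) (C.cen v) (5 * C.r) (5 * C.r + 10 * C.s * j) (2 * C.r)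

/-- The stub zone `cen v + {10r ≤ σ x_a ≤ 15r - 10s} × [-2r,2r]`. [cite: KozmaNitzan2024, §4 p. 26] -/
def Zone (v : Site 2) (δ : MDir) : Finset (Site 2) := sBox δ.1 (sgOf δ) (C.cen v) (10 * C.r) (15 * C.r - 10 * C.s) (2 * C.r)

/-! ## Membership -/

/-- Membership in a centred square of half-width `w`. [folklore] -/
theorem mem_sq_iff {v : Site 2} {w : ℕ} {t : Site 2} :
    t ∈ Finset.Icc (C.cen v - ((w : ℕ) : Site 2)) (C.cen v + ((w : ℕ) : Site 2)) ↔ ∀ i, C.cen v i - w ≤ t i ∧ t i ≤ C.cen v i + w := by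
  rw [mem_Icc_iff]
  refine forall_congr' fun i => ?_
  simp only [Pi.sub_apply, Pi.add_apply, Pi.natCast_apply]

/-- Membership in a planar signed box: the level along the axis and the transverse coordinate. [folklore] -/
theorem mem_psBox_iff {δ : MDir} {c : Site 2} {α β w : ℤ} {t : Site 2} :
    t ∈ sBox δ.1 (sgOf δ) c α β w ↔ (α ≤ sgOf δ * (t δ.1 - c δ.1) ∧ sgOf δ * (t δ.1 - c δ.1) ≤ β) ∧
      (c (oth δ.1) - w ≤ t (oth δ.1) ∧ t (oth δ.1) ≤ c (oth δ.1) + w) := by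
  rw [mem_sBox_iff (sgOf_sign δ)]
  refine and_congr_right fun _ => ⟨fun h => h _ (oth_ne δ.1), fun h j hj => ?_⟩
  rw [eq_oth_of_ne hj]; exact h

/-! ## One-dimensional comparisons (`m, n` macro-coordinates, `R = r`) -/

section OneD

variable {R : ℤ} (hR : 1 ≤ R)
include hR

/-- Two squares' intervals around different centre lines are disjoint. [folklore] -/
theorem oneD_sq_sq {m n t : ℤ} {w w' : ℤ} (hw : w + w' < 20 * R) (h1 : 20 * R * m - w ≤ t ∧ t ≤ 20 * R * m + w)
    (h2 : 20 * R * n - w' ≤ t ∧ t ≤ 20 * R * n + w') : m = n := by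
  by_contra hne
  rcases lt_or_gt_of_ne hne with h | h
  · have : 20 * R * m + 20 * R ≤ 20 * R * n := by nlinarith
    omega
  · have : 20 * R * n + 20 * R ≤ 20 * R * m := by nlinarith
    omega

/-- A square interval (half-width `≤ 5R`) misses a signed range `[5R+1, β]`, `β ≤ 35R - ... `: here the between/Efar ranges, which lie
strictly beyond `5R` from their own centre and (for `Btw`) strictly before `15R`. General form: level in `[5R+1, 15R-1]`. [folklore] -/
theorem oneD_sq_btw {m n t σ : ℤ} (hσ : σ = 1 ∨ σ = -1) (h1 : 20 * R * m - 5 * R ≤ t ∧ t ≤ 20 * R * m + 5 * R)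
    (h2 : 5 * R + 1 ≤ σ * (t - 20 * R * n) ∧ σ * (t - 20 * R * n) ≤ 15 * R - 1) : False := by
  rcases hσ with rfl | rfl
  · rcases le_or_gt m n with h | h
    · have : 20 * R * m ≤ 20 * R * n := by nlinarith
      omega
    · have : 20 * R * n + 20 * R ≤ 20 * R * m := by nlinarith
      omega
  · rcases le_or_gt n m with h | h
    · have : 20 * R * n ≤ 20 * R * m := by nlinarith
      omega
    · have : 20 * R * m + 20 * R ≤ 20 * R * n := by nlinarith
      omega

/-- A square interval around `m` meets the `Efar` range `[5R+1, 25R]` from `n` only if `m` is the far endpoint `n + σ`. [folklore] -/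
theorem oneD_sq_efar {m n t σ : ℤ} (hσ : σ = 1 ∨ σ = -1) (h1 : 20 * R * m - 5 * R ≤ t ∧ t ≤ 20 * R * m + 5 * R)
    (h2 : 5 * R + 1 ≤ σ * (t - 20 * R * n) ∧ σ * (t - 20 * R * n) ≤ 25 * R) : m = n + σ := by
  rcases hσ with rfl | rfl
  · by_contra hne
    rcases lt_or_gt_of_ne hne with h | h
    · rcases le_or_gt m n with h' | h'
      · have : 20 * R * m ≤ 20 * R * n := by nlinarith
        omega
      · omega
    · have : 20 * R * n + 40 * R ≤ 20 * R * m := by nlinarith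
      omega
  · by_contra hne
    rcases lt_or_gt_of_ne hne with h | h
    · have : 20 * R * m + 40 * R ≤ 20 * R * n := by nlinarith
      omega
    · rcases le_or_gt n m with h' | h'
      · have : 20 * R * n ≤ 20 * R * m := by nlinarith
        omega
      · omega

/-- Two between ranges (open strips strictly between consecutive centre lines) meet only if they are the same strip: with
`lo σ n := if σ = 1 then n else n - 1` the strip is `(20R·lo + 5R, 20R·lo + 15R)`. [folklore] -/
theorem oneD_btw_btw {n n' t σ σ' : ℤ} (hσ : σ = 1 ∨ σ = -1) (hσ' : σ' = 1 ∨ σ' = -1)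
    (h1 : 5 * R + 1 ≤ σ * (t - 20 * R * n) ∧ σ * (t - 20 * R * n) ≤ 15 * R - 1)
    (h2 : 5 * R + 1 ≤ σ' * (t - 20 * R * n') ∧ σ' * (t - 20 * R * n') ≤ 15 * R - 1) :
    (n = n' ∧ σ = σ') ∨ (n' = n + σ ∧ σ' = -σ) := by
  -- reduce both to the lower endpoint of the strip
  have key : ∀ {a b : ℤ}, 20 * R * a + 5 * R + 1 ≤ t → t ≤ 20 * R * a + 15 * R - 1 → 20 * R * b + 5 * R + 1 ≤ t →
      t ≤ 20 * R * b + 15 * R - 1 → a = b := by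
    intro a b ha1 ha2 hb1 hb2
    by_contra hne
    rcases lt_or_gt_of_ne hne with h | h
    · have : 20 * R * a + 20 * R ≤ 20 * R * b := by nlinarith
      omega
    · have : 20 * R * b + 20 * R ≤ 20 * R * a := by nlinarith
      omega
  rcases hσ with rfl | rfl <;> rcases hσ' with rfl | rfl
  · left; exact ⟨key (by omega) (by omega) (by omega) (by omega), rfl⟩
  · right
    have := key (a := n) (b := n' - 1) (by omega) (by omega) (by nlinarith) (by nlinarith)
    exact ⟨by omega, by norm_num⟩
  · right
    have := key (a := n - 1) (b := n') (by nlinarith) (by nlinarith) (by omega) (by omega)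
    exact ⟨by omega, by norm_num⟩
  · left
    have := key (a := n - 1) (b := n' - 1) (by nlinarith) (by nlinarith) (by nlinarith) (by nlinarith)
    exact ⟨by omega, rfl⟩

/-- A centre line meets no zone/stub-beyond range: `20 R k ∉ [10R, 15R - 1]·σ`-levels. More generally a level range `[α, β]` with
`0 < α` and `β < 20R` contains no multiple of `20R`. [folklore] -/
theorem oneD_cen_range {m n σ α β : ℤ} (hσ : σ = 1 ∨ σ = -1) (hα : 0 < α) (hβ : β < 20 * R)
    (h : α ≤ σ * (20 * R * m - 20 * R * n) ∧ σ * (20 * R * m - 20 * R * n) ≤ β) : False := by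
  rcases hσ with rfl | rfl
  · rcases le_or_gt m n with h' | h'
    · have : 20 * R * m ≤ 20 * R * n := by nlinarith
      omega
    · have : 20 * R * n + 20 * R ≤ 20 * R * m := by nlinarith
      omega
  · rcases le_or_gt n m with h' | h'
    · have : 20 * R * n ≤ 20 * R * m := by nlinarith
      omega
    · have : 20 * R * m + 20 * R ≤ 20 * R * n := by nlinarith
      omega

end OneD

/-! ## Containments -/

/-- `M_v ⊆ Q_v`. [folklore] -/
theorem M_subset_Q (v : Site 2) : C.M v ⊆ C.Q v := by
  intro t ht
  rw [M, C.mem_sq_iff] at ht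
  rw [Q, C.mem_sq_iff]
  intro i; have := ht i; push_cast at this ⊢; constructor <;> omega

/-- `Q_v ⊆ Cell_v`. [folklore] -/
theorem Q_subset_Cell (v : Site 2) : (C.Q v : Finset (Site 2)) ⊆ C.Cell v := by
  intro t ht
  rw [Q, C.mem_sq_iff] at ht
  rw [Cell, C.mem_sq_iff]
  intro i; have := ht i; push_cast at this ⊢; constructor <;> omega

/-- The centre of `x` lies in `Q_x`. [folklore] -/
theorem cen_mem_Q (x : Site 2) : C.cen x ∈ C.Q x := by
  rw [Q, C.mem_sq_iff]; intro i; push_cast; constructor <;> omega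

/-- `0 ∈ Q_0`. [folklore] -/
theorem zero_mem_Q_zero : (0 : Site 2) ∈ C.Q 0 := by
  have h := C.cen_mem_Q 0
  have h0 : C.cen 0 = 0 := by funext i; simp
  rwa [h0] at h

/-- `Btw_{v,δ} ⊆ Cell_v ∪ Cell_{v+δ}`. [folklore] -/
theorem Btw_subset_Cells (v : Site 2) (δ : MDir) : C.Btw v δ ⊆ C.Cell v ∪ C.Cell (v + stepVec δ) := by
  intro t ht
  rw [Btw, mem_psBox_iff] at ht
  obtain ⟨⟨h1, h2⟩, h3, h4⟩ := ht
  rw [Finset.mem_union, Cell, Cell, C.mem_sq_iff, C.mem_sq_iff]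
  have hf := C.cen_add_stepVec_fst v δ
  have ho := C.cen_add_stepVec_oth v δ
  by_cases hlev : sgOf δ * (t δ.1 - C.cen v δ.1) ≤ 10 * C.r
  · left
    intro i
    rcases eq_or_ne i δ.1 with rfl | hi
    · rcases sgOf_sign δ with hs | hs <;> rw [hs] at h1 h2 hlev <;> push_cast <;> constructor <;> omega
    · rw [eq_oth_of_ne hi]; push_cast; constructor <;> omega
  · right
    intro i
    rcases eq_or_ne i δ.1 with rfl | hi
    · rw [hf]
      rcases sgOf_sign δ with hs | hs <;> rw [hs] at h1 h2 hlev ⊢ <;> push_cast <;> constructor <;> omega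
    · rw [eq_oth_of_ne hi, ho]; push_cast; constructor <;> omega

/-- `H^j ⊆ Q_v ∪ Btw` for `j + 1 ≤ K`. [folklore] -/
theorem Stub_subset_Q_union_Btw (v : Site 2) (δ : MDir) {j : ℕ} (hj : j < C.K) : (C.Stub v δ j : Finset (Site 2)) ⊆ C.Q v ∪ C.Btw v δ := by
  intro t ht
  rw [Stub, mem_psBox_iff] at ht
  obtain ⟨⟨h1, h2⟩, h3, h4⟩ := ht
  have hsj : 10 * (C.s : ℤ) * j ≤ 10 * C.r - 10 * C.s := by
    have : C.s * (j + 1) ≤ C.s * C.K := Nat.mul_le_mul_left _ (by omega)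
    have hr : (C.r : ℤ) = C.K * C.s := by simp [r]
    nlinarith
  have hs1 := C.hs
  rw [Finset.mem_union, Q, C.mem_sq_iff, Btw, mem_psBox_iff]
  by_cases hlev : sgOf δ * (t δ.1 - C.cen v δ.1) ≤ 5 * C.r
  · left
    intro i
    rcases eq_or_ne i δ.1 with rfl | hi
    · rcases sgOf_sign δ with hs | hs <;> rw [hs] at h1 hlev <;> push_cast <;> constructor <;> omega
    · rw [eq_oth_of_ne hi]; push_cast; constructor <;> omega
  · right
    refine ⟨⟨by omega, by omega⟩, by omega, by omega⟩

/-- `H^j ⊆ Cell_v ∪ Zone` for `j + 1 ≤ K`. [folklore] -/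
theorem Stub_subset_Cell_union_Zone (v : Site 2) (δ : MDir) {j : ℕ} (hj : j < C.K) : (C.Stub v δ j : Finset (Site 2)) ⊆ C.Cell v ∪ C.Zone v δ := by
  intro t ht
  rw [Stub, mem_psBox_iff] at ht
  obtain ⟨⟨h1, h2⟩, h3, h4⟩ := ht
  have hsj : 10 * (C.s : ℤ) * j ≤ 10 * C.r - 10 * C.s := by
    have : C.s * (j + 1) ≤ C.s * C.K := Nat.mul_le_mul_left _ (by omega)
    have hr : (C.r : ℤ) = C.K * C.s := by simp [r]
    nlinarith
  rw [Finset.mem_union, Cell, C.mem_sq_iff, Zone, mem_psBox_iff]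
  by_cases hlev : sgOf δ * (t δ.1 - C.cen v δ.1) ≤ 10 * C.r
  · left
    intro i
    rcases eq_or_ne i δ.1 with rfl | hi
    · rcases sgOf_sign δ with hs | hs <;> rw [hs] at h1 hlev <;> push_cast <;> constructor <;> omega
    · rw [eq_oth_of_ne hi]; push_cast; constructor <;> omega
  · right
    refine ⟨⟨by omega, by omega⟩, by omega, by omega⟩

/-- `E^far ⊆ Btw ∪ Q_{v+δ}`. [folklore] -/
theorem Efar_subset_Btw_union_Q (v : Site 2) (δ : MDir) : (C.Efar v δ : Finset (Site 2)) ⊆ C.Btw v δ ∪ C.Q (v + stepVec δ) := by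
  intro t ht
  rw [Efar, mem_psBox_iff] at ht
  obtain ⟨⟨h1, h2⟩, h3, h4⟩ := ht
  rw [Finset.mem_union, Btw, mem_psBox_iff, Q, C.mem_sq_iff]
  by_cases hlev : sgOf δ * (t δ.1 - C.cen v δ.1) ≤ 15 * C.r - 1
  · left
    exact ⟨⟨by omega, by omega⟩, by omega, by omega⟩
  · right
    have hf := C.cen_add_stepVec_fst v δ
    have ho := C.cen_add_stepVec_oth v δ
    intro i
    rcases eq_or_ne i δ.1 with rfl | hi
    · rw [hf]
      rcases sgOf_sign δ with hs | hs <;> rw [hs] at h2 hlev ⊢ <;> push_cast at h2 ⊢ <;> constructor <;> omega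
    · rw [eq_oth_of_ne hi, ho]; push_cast at h3 h4 ⊢; constructor <;> omega

end PCells

end Transplant

end Summit.CriticalPhenomena.PercolationContinuityZ3.Theorems

end
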